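import Summits.BirchSwinnertonDyer.BirchSwinnertonDyer.Theorems.Rank1ResidualIntModelReduction
import Summits.BirchSwinnertonDyer.Rank1Residual.GaloisImage.FrobeniusOrderWitness
import Summits.BirchSwinnertonDyer.Rank1Residual.X11b.CertificateCheckBridge
import Summits.BirchSwinnertonDyer.Rank1Residual.X11b.AnticyclotomicLinks
import Summits.BirchSwinnertonDyer.Rank1Residual.X11b.AnticyclotomicEmbedding
import Literature.NumberTheory.EllipticCurves.BurungaleSkinner2023.Curve14a1TwistsCertificate
import Literature.NumberTheory.EllipticCurves.RationalIsogenyFrobeniusCriterion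
import Literature.NumberTheory.EllipticCurves.Rank1Residual.X11Three
import Literature.NumberTheory.EllipticCurves.HeegnerHypothesisKroneckerProofs
import Literature.NumberTheory.EllipticCurves.HeegnerPointsImaginaryQuadraticProofs
import Literature.NumberTheory.QuadraticFields.FundamentalDiscriminant
import Mathlib.Tactic.NormNum.LegendreSymbol
import HarnessLib

/-!
# `UniversalToricDescent.TwinAlgMuZeroAtThree` (stmt-BirchSwinnertonDyer-24737), negative-side
# support III: the R2 guards are PROPER cuts of the R1 text (this file does NOT refute the crux)

The crux is the R2 weakening of the vetted R1 text (stmt-24254: bucket guard `¬ Addv E' 3`, no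
parity condition on `d_K`) by (i) the BUCKET GUARD `Mult E' 3 ∧ 3 ∤ ord₃ Δ_min ∨ GoodSS E' 3 ∧ a₃ = 0`
and (ii) `Odd d_K`. Both cuts are strict — kernel witnesses:

* `not_bucketGuard_11a1` — `11a1 = [0,−1,1,−10,−20]` is not additive at `3` (good reduction,
  `3 ∤ Δ = −11⁵`: it passes R1's guard) yet fails BOTH branches of R2's guard: not multiplicative
  (good excludes multiplicative, AEC VII.5.1) and not `GoodSS` (`#Ẽ(𝔽₃) = 5`, `a₃ = −1`, good
  ORDINARY). Bucket A (good ordinary `p = 3`, the case of [BCS2024 = arXiv:2405.00270, Prop. 4.2.2])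
  is exactly what R2 drops.
* `exists_heegner_split_not_odd` — `K = ℚ(√−14)` (`d_K = −56`) is imaginary quadratic and Heegner
  for `15` (`(−56/3) = (−56/5) = 1`), so `3` splits and every other field-side hypothesis of the crux
  holds for the bucket-B curve `15a1` (`Negative/Habitat.lean`) — but `d_K` is even: the `Odd d_K`
  guard (a BDP-engine normalisation) removes admissible Heegner fields.

So R2 ⊊ R1 on the curve side and on the field side (information for the planner's BC5 / T1(c)
bookkeeping: `TwinAlgMuZeroAtThree` is strictly weaker than stmt-24254 as a ∀-statement, and a
refutation of it would a fortiori refute stmt-24254 only through a bucket-B/C₀, odd-`d_K` witness).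

No new definition; no statement of the route is asserted positively. Disprover seat
`cdisprove-stmt-BirchSwinnertonDyer-24737-g0` (refuter lineage), 2026-08-29.

References: [CremonaAlgorithms1997] Table 1 (curve 11a1); [SilvermanAEC2009] VII.1 Rem. 1.1, VII.5
Prop. 5.1; [Marcus1977] Ch. 2 Thm. 1, Ch. 3 Thm. 25; [GrossLMS1991] §1; [IrelandRosen1990] §8.1.
-/

noncomputable section

open scoped Classical

-- D-0017: single-problem summit, so `Summit.BirchSwinnertonDyer.BirchSwinnertonDyer.…` repeats a
-- namespace BY DESIGN.
set_option linter.dupNamespace false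

namespace Summit.BirchSwinnertonDyer.BirchSwinnertonDyer.Theorems.TwinAlgMuZeroAtThree.Negative

open WeierstrassCurve NumberField IsDedekindDomain
open Literature.NumberTheory.EllipticCurves Literature.NumberTheory.EllipticCurves.Rank1Residual
open Literature.NumberTheory.EllipticCurves.ModularForms (ModularParametrizationData
  nonempty_modularParametrizationData)
open Literature.NumberTheory.EllipticCurves.BurungaleSkinner2023 (conductorNorm_baseChange_int_of_isCoprime
  hasMultiplicativeReductionAtPrime_baseChange_int_of_isCoprime
  hasGoodReductionAtPrime_baseChange_int_of_not_dvd)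
open Literature.NumberTheory.EllipticCurves.Rank1Residual.X11RankOneCertificates (countPoints)
open Summit.BirchSwinnertonDyer.BirchSwinnertonDyer.Rank1Residual (IntModel.integralModelInt_eq_of_map_eq
  IntModel.minimalDiscriminantInt_eq IntModel.frobeniusTrace_eq IntModel.padicValInt_eq_of_dvd_of_not_dvd)
open Summit.BirchSwinnertonDyer.Rank1Residual.X11b
open Summit.BirchSwinnertonDyer.Rank1Residual.GaloisImage

/-! ### §4 The R2 guards are proper cuts of the R1 text -/

/-- `Δ(11a1) = −161051 = −11⁵`. [cite: CremonaAlgorithms1997, Table 1 (curve 11a1)] -/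
theorem M11_Δ : (⟨0, -1, 1, -10, -20⟩ : WeierstrassCurve ℤ).Δ = -161051 := by
  norm_num [WeierstrassCurve.Δ, WeierstrassCurve.b₂, WeierstrassCurve.b₄, WeierstrassCurve.b₆,
    WeierstrassCurve.b₈]

/-- `c₄(11a1) = 496`. [cite: CremonaAlgorithms1997, Table 1 (curve 11a1)] -/
theorem M11_c₄ : (⟨0, -1, 1, -10, -20⟩ : WeierstrassCurve ℤ).c₄ = 496 := by
  norm_num [WeierstrassCurve.c₄, WeierstrassCurve.b₂, WeierstrassCurve.b₄]

/-- `11a1` is an elliptic curve. [cite: CremonaAlgorithms1997, Table 1 (curve 11a1)] -/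
theorem isElliptic_11a1 : ((⟨0, -1, 1, -10, -20⟩ : WeierstrassCurve ℤ).baseChange ℚ).IsElliptic :=
  Literature.NumberTheory.EllipticCurves.isElliptic_baseChange_int _ (by rw [M11_Δ]; decide)

/-- Cremona's model `11a1` is globally minimal (`|Δ| < 3¹²`, `Δ` odd).
[cite: SilvermanAEC2009, VII.1 Remark 1.1] -/
theorem isGloballyMinimal_11a1 :
    ((⟨0, -1, 1, -10, -20⟩ : WeierstrassCurve ℤ).baseChange ℚ).IsGloballyMinimal :=
  isGloballyMinimal_baseChange_int _ (forall_not_pow_dvd_or_of_bound _ (B := 3)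
    (by rw [M11_Δ]; decide) (by rw [M11_Δ]; decide) (by
      intro p hp hpr
      have hp3 : p < 3 := Finset.mem_range.mp hp
      interval_cases p
      · exact absurd hpr (by decide)
      · exact absurd hpr (by decide)
      · left; rw [M11_Δ]; decide))

/-- The tree's integral model of `11a1 ⊗ ℚ` is the integer equation itself. [folklore] -/
theorem integralModelInt_11a1 [((⟨0, -1, 1, -10, -20⟩ : WeierstrassCurve ℤ).baseChange ℚ).IsGloballyMinimal] :
    integralModelInt ((⟨0, -1, 1, -10, -20⟩ : WeierstrassCurve ℤ).baseChange ℚ) =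
      (⟨0, -1, 1, -10, -20⟩ : WeierstrassCurve ℤ) :=
  IntModel.integralModelInt_eq_of_map_eq _ (baseChange_int_eq_map _).symm

/-- `#Ẽ(𝔽₃) = 5` for `11a1` (`a₃ = −1`). [cite: IrelandRosen1990, Prop. 5.1.2 and §8.1] -/
theorem card_11a1_mod3 :
    Nat.card (((⟨0, -1, 1, -10, -20⟩ : WeierstrassCurve ℤ).map (Int.castRingHom (ZMod 3))).toAffine.Point) = 5 := by
  have h := natCard_point_eq_countPoints 0 (-1) 1 (-10) (-20) 3 (by norm_num) (by rw [M11_Δ]; decide)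
  have h' : countPoints [0, -1, 1, -10, -20] 3 = 5 := by decide +kernel
  exact_mod_cast h.trans h'

/-- **The bucket guard of R2 is a PROPER cut of R1's `¬ Addv W' 3`**: `11a1` is not additive at `3`
(good reduction, `3 ∤ Δ = −11⁵`) but satisfies neither branch of the guard — not multiplicative at `3`
(good excludes multiplicative, AEC VII.5.1) and not `GoodSS` (`a₃ = 3 + 1 − 5 = −1`, `3 ∤ a₃`: good
ORDINARY). Bucket A (good ordinary `p = 3`) is exactly what R2 drops from stmt-24254.
[cite: SilvermanAEC2009, VII.5 Prop. 5.1] -/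
theorem not_bucketGuard_11a1 :
    haveI := isGloballyMinimal_11a1
    ¬ Addv ((⟨0, -1, 1, -10, -20⟩ : WeierstrassCurve ℤ).baseChange ℚ) 3 ∧
    ¬ (Mult ((⟨0, -1, 1, -10, -20⟩ : WeierstrassCurve ℤ).baseChange ℚ) 3 ∧
        ¬ 3 ∣ padicValInt 3 ((⟨0, -1, 1, -10, -20⟩ : WeierstrassCurve ℤ).baseChange ℚ).minimalDiscriminantInt ∨
      GoodSS ((⟨0, -1, 1, -10, -20⟩ : WeierstrassCurve ℤ).baseChange ℚ) 3 ∧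
        ((⟨0, -1, 1, -10, -20⟩ : WeierstrassCurve ℤ).baseChange ℚ).frobeniusTrace 3 = 0) := by
  haveI := isElliptic_11a1
  haveI := isGloballyMinimal_11a1
  have hgood : ((⟨0, -1, 1, -10, -20⟩ : WeierstrassCurve ℤ).baseChange ℚ).HasGoodReductionAtPrime 3 :=
    hasGoodReductionAtPrime_baseChange_int_of_not_dvd _ (by rw [M11_Δ]; decide)
  have ha : ((⟨0, -1, 1, -10, -20⟩ : WeierstrassCurve ℤ).baseChange ℚ).frobeniusTrace 3 = -1 := by
    rw [IntModel.frobeniusTrace_eq integralModelInt_11a1 card_11a1_mod3]; norm_num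
  refine ⟨fun h ↦ h.1 hgood, ?_⟩
  rintro (⟨hm, -⟩ | ⟨⟨-, hdvd⟩, -⟩)
  · exact not_hasGoodReductionAtPrime_of_hasMultiplicativeReductionAtPrime 3 hm hgood
  · rw [ha] at hdvd; revert hdvd; decide

/-- **The `Odd d_K` guard of R2 is a PROPER cut**: `K = ℚ(√−14)` (`d_K = −56`) is imaginary
quadratic, Heegner for `15` (`(−56/3) = (−56/5) = 1`) — so `3` splits and all the other field-side
hypotheses of the crux hold for the bucket-B curve `15a1` — but `d_K` is even.
[cite: GrossLMS1991, §1 (p. 235)] -/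
theorem exists_heegner_split_not_odd :
    ∃ (K : Type) (_ : Field K) (_ : NumberField K), IsImaginaryQuadratic K ∧
      SatisfiesHeegnerHypothesis 15 K ∧ SplitsIn K 3 ∧ ¬ Odd (NumberField.discr K) := by
  -- the field: `d = −56 = 4·(−14)`, `−14 ≡ 2 (mod 4)` squarefree (Marcus Ch. 2 Thm. 1)
  obtain ⟨K, _, _, hK2, hd⟩ :=
    Literature.NumberTheory.QuadraticFields.Quadratic.exists_numberField_discr_eq (D := -56)
      (Or.inr ⟨by norm_num, by norm_num, Int.squarefree_natAbs.mp (by decide +kernel)⟩)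
  have hK : IsImaginaryQuadratic K := isImaginaryQuadratic_iff_discr_neg.2 ⟨hK2, by rw [hd]; norm_num⟩
  have hH : SatisfiesHeegnerHypothesis 15 K := by
    rw [satisfiesHeegnerHypothesis_iff_kronecker 15 K hK.1, hd]
    intro p hp hpN
    have hp35 : p = 3 ∨ p = 5 := by
      rcases (Nat.Prime.dvd_mul hp).mp (show p ∣ 3 * 5 from hpN) with h | h
      · exact Or.inl ((Nat.prime_dvd_prime_iff_eq hp Nat.prime_three).mp h)
      · exact Or.inr ((Nat.prime_dvd_prime_iff_eq hp (by norm_num)).mp h)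
    rcases hp35 with rfl | rfl
    · exact ⟨fun h ↦ absurd h (by norm_num), fun _ ↦ by norm_num⟩
    · exact ⟨fun h ↦ absurd h (by norm_num), fun _ ↦ by norm_num⟩
  exact ⟨K, _, _, hK, hH, hH 3 Nat.prime_three (by norm_num), by rw [hd]; decide⟩

end Summit.BirchSwinnertonDyer.BirchSwinnertonDyer.Theorems.TwinAlgMuZeroAtThree.Negative

end
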